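import Literature.Analysis.Complex.StripResidueFormula
import Mathlib.Analysis.Fourier.Inversion
import Summits.RiemannHypothesis.RiemannHypothesis.Theorems.DBNStripCorrector
import HarnessLib

/-!
# RiemannHypothesis / DBN — `StripKernelSymbol`: the Fourier symbol of the strip kernel

RH-FREE harmonic analysis (THEORY-R4 §2 of the `pub-dbn` cell, `Sketch4.lean` sha16 3a8b9a024097398f;
support-grade).  The typed statement `StripKernelSymbol` (byte-verbatim `DbnTheory4.StripKernelSymbol`) and
its proof: for `|η| < 1` and every real `k`,
`∫ Q^{(η)}(x) cos(kx) dx = cosh(ηk)/cosh k`, where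
`Q^{(η)}(x) = ½ cos(πη/2) cosh(πx/2)/(cosh²(πx/2) − sin²(πη/2))` is `stripKernel η x`
(`Theorems/DBNStripCorrector.lean`): the two-boundary Poisson kernel of the strip `|Im w| < 1` has Fourier
symbol `cosh(ηk)/cosh k` (the bounded harmonic function on the strip with boundary values `cos(kx)` on both
lines is `cos(kx)·cosh(kη)/cosh k`).

Proof.  No contour integration is redone here: the tree's Rieffel–van Daele strip formula
(`Literature.Analysis.Complex.RieffelVanDaele_strip_formula` — Cauchy's theorem on `|Re z| ≤ 1/2` against
the weight `e^{−φt}/(e^{πt}+e^{−πt})`, `|φ| < π`) applied to the entire function `z ↦ e^{cz}` (`c` real)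
gives the two-sided Laplace–Fourier transform of `sech`,
`∫ e^{−φt} e^{ict} /(e^{πt}+e^{−πt}) dt = 1/(2 cosh((c+iφ)/2))`,
whose real part at `φ = πη`, `c = πx` is `Q^{(η)}(x)`.  In Mathlib's normalisation this reads
`𝓕[t ↦ e^{−πηt}/(e^{πt}+e^{−πt})](w) = 1/(2 cosh(−πw + iπη/2))`; Fourier inversion
(`Continuous.fourierInv_fourier_eq`), the substitution `w = −x/2` and the two evaluations `t = ±k/π`
yield `∫ cos(kx)/cosh(π(x+iη)/2) dx = 2 cosh(ηk)/cosh k`, whose real part is the claim.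

`--supports stmt-RiemannHypothesis-0274`; support-grade, LOWERS NOTHING; nothing here bears on the truth
of RH.
-/

noncomputable section

-- D-0017: `Summit.<S>.<S>.…` is the designed namespace of a single-problem summit.
set_option linter.dupNamespace false

open scoped Real FourierTransform
open MeasureTheory Set Filter Complex Literature.Analysis.Complex

namespace Summit.RiemannHypothesis.RiemannHypothesis.Theorems.DbnTheory

/-- strip kernel: Fourier (cosine) symbol `cosh(ηk)/cosh k`.  Verbatim `DbnTheory4.StripKernelSymbol`. -/
def StripKernelSymbol : Prop :=
  ∀ η k : ℝ, |η| < 1 → ∫ x, stripKernel η x * Real.cos (k * x) = Real.cosh (η * k) / Real.cosh k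

/-! ## `cosh` away from its zeros: `|cosh z| ≥ cos(Im z) · cosh(Re z)` -/

/-- `|cosh z|² = cosh²(Re z) − sin²(Im z)`. [folklore] -/
theorem normSq_cosh_eq (z : ℂ) :
    normSq (Complex.cosh z) = Real.cosh z.re ^ 2 - Real.sin z.im ^ 2 := by
  conv_lhs => rw [← re_add_im z]
  exact normSq_cosh_ofReal_add_mul_I z.re z.im

/-- `cos(Im z) · cosh(Re z) ≤ |cosh z|` whenever `cos(Im z) ≥ 0`. [folklore] -/
theorem cos_mul_cosh_le_norm_cosh (z : ℂ) (hz : 0 ≤ Real.cos z.im) :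
    Real.cos z.im * Real.cosh z.re ≤ ‖Complex.cosh z‖ := by
  have h1 : 1 ≤ Real.cosh z.re := Real.one_le_cosh _
  have h0 : 0 ≤ Real.cos z.im * Real.cosh z.re := mul_nonneg hz (by linarith)
  have hsq : (Real.cos z.im * Real.cosh z.re) ^ 2 ≤ ‖Complex.cosh z‖ ^ 2 := by
    rw [Complex.sq_norm, normSq_cosh_eq]
    have hc := Real.sin_sq_add_cos_sq z.im
    have h2 : 1 ≤ Real.cosh z.re ^ 2 := by nlinarith
    nlinarith [mul_nonneg (sub_nonneg.2 h2) (sq_nonneg (Real.sin z.im))]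
  exact (pow_le_pow_iff_left₀ h0 (norm_nonneg _) two_ne_zero).mp hsq

/-- `cosh z ≠ 0` for `|Im z| < π/2`. [folklore] -/
theorem cosh_ne_zero_of_abs_im_lt {z : ℂ} (hz : |z.im| < π / 2) : Complex.cosh z ≠ 0 := by
  obtain ⟨h1, h2⟩ := abs_lt.mp hz
  have hcos : 0 < Real.cos z.im := Real.cos_pos_of_mem_Ioo ⟨by linarith, by linarith⟩
  have h := cos_mul_cosh_le_norm_cosh z hcos.le
  have hpos : 0 < Real.cos z.im * Real.cosh z.re := mul_pos hcos (Real.cosh_pos _)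
  intro h0
  rw [h0, norm_zero] at h
  linarith

/-- `|1/cosh z| ≤ 1/(cos(Im z) cosh(Re z))` for `|Im z| < π/2`. [folklore] -/
theorem norm_inv_cosh_le {z : ℂ} (hz : |z.im| < π / 2) :
    ‖(Complex.cosh z)⁻¹‖ ≤ (Real.cos z.im)⁻¹ * (Real.cosh z.re)⁻¹ := by
  obtain ⟨h1, h2⟩ := abs_lt.mp hz
  have hcos : 0 < Real.cos z.im := Real.cos_pos_of_mem_Ioo ⟨by linarith, by linarith⟩
  have hpos : 0 < Real.cos z.im * Real.cosh z.re := mul_pos hcos (Real.cosh_pos _)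
  rw [norm_inv, ← mul_inv]
  exact inv_anti₀ hpos (cos_mul_cosh_le_norm_cosh z hcos.le)

/-! ## The weight `e^{−φt}/(e^{πt}+e^{−πt})` and its Laplace–Fourier transform -/

/-- The Rieffel–van Daele weight is integrable for `|φ| < π` (its continuity, also recorded as
`Literature.MathematicalPhysics.AQFT.continuous_weight` in the Tomita–Takesaki development, is re-derived inline
to keep this file's import closure inside harmonic analysis). [folklore] -/
theorem integrable_weight {φ : ℝ} (hφ : |φ| < π) : Integrable (weight φ) := by
  have hcont : Continuous (weight φ) := by
    unfold weight
    exact Continuous.div (by fun_prop) (by fun_prop) (fun t => by positivity)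
  refine (integrable_exp_neg_mul_abs (sub_pos.2 hφ)).mono' hcont.aestronglyMeasurable ?_
  exact Eventually.of_forall fun t => by rw [Real.norm_eq_abs]; exact abs_weight_le φ t

/-- **Laplace–Fourier transform of `sech`**: for `|φ| < π` and real `c`,
`∫ e^{−φt} e^{ict} dt/(e^{πt} + e^{−πt}) = 1/(2 cosh((c + iφ)/2))` — the Rieffel–van Daele strip formula for
the entire function `z ↦ e^{cz}`. [folklore] -/
theorem integral_weight_mul_exp {φ : ℝ} (hφ : |φ| < π) (c : ℝ) :
    ∫ t : ℝ, (weight φ t : ℂ) * Complex.exp (c * t * I) = (2 * Complex.cosh ((c + φ * I) / 2))⁻¹ := by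
  set f : ℂ → ℂ := fun z => Complex.exp (c * z) with hf
  have hcont : ContinuousOn f closedStrip := (by rw [hf]; fun_prop : Continuous f).continuousOn
  have hdiff : DifferentiableOn ℂ f openStrip := (by rw [hf]; fun_prop : Differentiable ℂ f).differentiableOn
  have hbdd : ∀ z ∈ closedStrip, ‖f z‖ ≤ Real.exp (|c| / 2) := by
    intro z hz
    simp only [closedStrip, mem_setOf_eq] at hz
    rw [hf]
    dsimp only
    rw [Complex.norm_exp, Real.exp_le_exp]
    simp only [mul_re, ofReal_re, ofReal_im, zero_mul, sub_zero]
    calc c * z.re ≤ |c * z.re| := le_abs_self _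
      _ = |c| * |z.re| := abs_mul _ _
      _ ≤ |c| * (1 / 2) := by gcongr
      _ = |c| / 2 := by ring
  have key := RieffelVanDaele_strip_formula hφ hcont hdiff hbdd
  have hf0 : f 0 = 1 := by rw [hf]; simp
  -- the boundary values of `e^{cz}`
  have hA : ∀ t : ℝ, Complex.exp (I * (φ / 2)) * f ((1 / 2 : ℂ) + t * I) +
        Complex.exp (-(I * (φ / 2))) * f (-(1 / 2 : ℂ) + t * I)
      = 2 * Complex.cosh ((c + φ * I) / 2) * Complex.exp (c * t * I) := by
    intro t
    rw [hf]
    dsimp only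
    rw [← Complex.exp_add, ← Complex.exp_add, Complex.two_cosh, add_mul, ← Complex.exp_add,
      ← Complex.exp_add]
    congr 1
    · congr 1; ring
    · congr 1; ring
  simp_rw [hA] at key
  have hpull : ∫ t : ℝ, (weight φ t : ℂ) * (2 * Complex.cosh ((c + φ * I) / 2) * Complex.exp (c * t * I))
      = 2 * Complex.cosh ((c + φ * I) / 2) * ∫ t : ℝ, (weight φ t : ℂ) * Complex.exp (c * t * I) := by
    rw [← MeasureTheory.integral_const_mul]
    congr 1
    funext t
    ring
  rw [hpull, hf0] at key
  exact eq_inv_of_mul_eq_one_right key.symm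

/-- The Fourier transform (Mathlib normalisation `𝓕 g(w) = ∫ e^{−2πitw} g(t) dt`) of
`t ↦ e^{−πηt}/(e^{πt}+e^{−πt})`, `|η| < 1`: `𝓕 g (w) = 1/(2 cosh(−πw + iπη/2))`. [folklore] -/
theorem fourier_weight {η : ℝ} (hη : |η| < 1) (w : ℝ) :
    𝓕 (fun t : ℝ => (weight (π * η) t : ℂ)) w = (2 * Complex.cosh (-(π * w) + (π * η / 2) * I))⁻¹ := by
  have hφ : |π * η| < π := by
    rw [abs_mul, abs_of_pos Real.pi_pos]
    nlinarith [abs_nonneg η, Real.pi_pos]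
  have h := integral_weight_mul_exp hφ (-2 * π * w)
  have harg : (((-2 * π * w : ℝ) : ℂ) + ((π * η : ℝ) : ℂ) * I) / 2 = -(π * w) + (π * η / 2) * I := by
    push_cast; ring
  rw [harg] at h
  rw [← h, Real.fourier_real_eq_integral_exp_smul]
  congr 1
  funext t
  rw [smul_eq_mul, mul_comm]
  congr 1
  congr 1
  push_cast
  ring

/-- `𝓕 g` is integrable (it is `O(e^{−π|w|})`). [folklore] -/
theorem integrable_fourier_weight {η : ℝ} (hη : |η| < 1) :
    Integrable (𝓕 (fun t : ℝ => (weight (π * η) t : ℂ))) := by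
  have hfun : 𝓕 (fun t : ℝ => (weight (π * η) t : ℂ)) =
      fun w : ℝ => (2 * Complex.cosh (-(π * w) + (π * η / 2) * I))⁻¹ := by
    funext w; exact fourier_weight hη w
  rw [hfun]
  obtain ⟨hη1, hη2⟩ := abs_lt.mp hη
  have him : ∀ w : ℝ, (-(π * w) + (π * η / 2) * I : ℂ).im = π * η / 2 := by
    intro w; simp
  have hre : ∀ w : ℝ, (-(π * w) + (π * η / 2) * I : ℂ).re = -(π * w) := by
    intro w; simp
  have hb : |π * η / 2| < π / 2 := by
    rw [abs_div, abs_mul, abs_of_pos Real.pi_pos, abs_two]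
    nlinarith [abs_nonneg η, Real.pi_pos, abs_lt.mp hη]
  have hcos : 0 < Real.cos (π * η / 2) := by
    apply Real.cos_pos_of_mem_Ioo
    constructor <;> nlinarith [Real.pi_pos]
  have hne : ∀ w : ℝ, Complex.cosh (-(π * w) + (π * η / 2) * I) ≠ 0 := by
    intro w
    apply cosh_ne_zero_of_abs_im_lt
    rw [him]; exact hb
  have hcont : Continuous fun w : ℝ => (2 * Complex.cosh (-(π * w) + (π * η / 2) * I))⁻¹ :=
    Continuous.inv₀ (by fun_prop) (fun w => mul_ne_zero two_ne_zero (hne w))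
  refine ((integrable_inv_exp_add_exp.const_mul (Real.cos (π * η / 2))⁻¹)).mono'
    hcont.aestronglyMeasurable (Eventually.of_forall fun w => ?_)
  have h1 := norm_inv_cosh_le (z := -(π * w) + (π * η / 2) * I) (by rw [him]; exact hb)
  rw [him, hre, Real.cosh_neg, Real.cosh_eq] at h1
  rw [mul_inv, norm_mul, norm_inv, RCLike.norm_ofNat]
  have h2 : 0 < Real.exp (π * w) + Real.exp (-(π * w)) := by positivity
  calc (2 : ℝ)⁻¹ * ‖(Complex.cosh (-(π * w) + (π * η / 2) * I))⁻¹‖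
      ≤ 2⁻¹ * ((Real.cos (π * η / 2))⁻¹ * ((Real.exp (π * w) + Real.exp (-(π * w))) / 2)⁻¹) := by
        gcongr
    _ = (Real.cos (π * η / 2))⁻¹ * (1 / (Real.exp (π * w) + Real.exp (-(π * w)))) := by
        field_simp

/-- **Fourier inversion** for the weight: for `|η| < 1` and every real `t`,
`e^{−πηt}/(e^{πt}+e^{−πt}) = ¼ ∫ e^{−iπxt} / cosh(π(x+iη)/2) dx`. [folklore] -/
theorem weight_eq_integral {η : ℝ} (hη : |η| < 1) (t : ℝ) :
    (weight (π * η) t : ℂ) = (1 / 4 : ℂ) * ∫ x : ℝ, Complex.exp (-(π * x * t) * I) *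
      (Complex.cosh (((π * x / 2 : ℝ) : ℂ) + ((π * η / 2 : ℝ) : ℂ) * I))⁻¹ := by
  have hφ : |π * η| < π := by
    rw [abs_mul, abs_of_pos Real.pi_pos]
    nlinarith [abs_nonneg η, Real.pi_pos]
  have hcont : Continuous fun t : ℝ => (weight (π * η) t : ℂ) := by
    refine continuous_ofReal.comp ?_
    unfold weight
    exact Continuous.div (by fun_prop) (by fun_prop) (fun t => by positivity)
  have hint : Integrable fun t : ℝ => (weight (π * η) t : ℂ) := (integrable_weight hφ).ofReal
  have hinv := congrFun (hcont.fourierInv_fourier_eq hint (integrable_fourier_weight hη)) t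
  rw [← hinv, Real.fourierInv_eq_fourier_neg, Real.fourier_real_eq_integral_exp_smul]
  simp_rw [fourier_weight hη]
  -- substitute `v = -x/2`
  have hsub := Measure.integral_comp_mul_left
    (fun v : ℝ => Complex.exp (↑(-2 * π * v * -t) * I) • (2 * Complex.cosh (-(π * v) + (π * η / 2) * I))⁻¹)
    (-1 / 2 : ℝ)
  have habs : |(-1 / 2 : ℝ)⁻¹| = 2 := by norm_num
  rw [habs] at hsub
  -- `∫ F = ½ ∫ F(−x/2)`
  have hhalf : ∫ v : ℝ, Complex.exp (↑(-2 * π * v * -t) * I) • (2 * Complex.cosh (-(π * v) + (π * η / 2) * I))⁻¹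
      = (1 / 2 : ℂ) * ∫ x : ℝ, Complex.exp (↑(-2 * π * ((-1 / 2 : ℝ) * x) * -t) * I) •
          (2 * Complex.cosh (-(π * ((-1 / 2 : ℝ) * x : ℝ)) + (π * η / 2) * I))⁻¹ := by
    rw [hsub, ← Complex.coe_smul, smul_eq_mul]
    push_cast
    ring
  rw [hhalf]
  have hFG : ∀ x : ℝ, Complex.exp (↑(-2 * π * ((-1 / 2 : ℝ) * x) * -t) * I) •
          (2 * Complex.cosh (-(π * ((-1 / 2 : ℝ) * x : ℝ)) + (π * η / 2) * I))⁻¹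
      = (1 / 2 : ℂ) * (Complex.exp (-(π * x * t) * I) *
          (Complex.cosh (((π * x / 2 : ℝ) : ℂ) + ((π * η / 2 : ℝ) : ℂ) * I))⁻¹) := by
    intro x
    have harg1 : (↑(-2 * π * ((-1 / 2 : ℝ) * x) * -t) : ℂ) * I = -(π * x * t) * I := by push_cast; ring
    have harg2 : (-(π * ((-1 / 2 : ℝ) * x : ℝ)) + (π * η / 2) * I : ℂ)
        = ((π * x / 2 : ℝ) : ℂ) + ((π * η / 2 : ℝ) : ℂ) * I := by push_cast; ring
    rw [smul_eq_mul, mul_inv, harg1, harg2]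
    ring
  simp_rw [hFG]
  rw [MeasureTheory.integral_const_mul]
  ring

/-- The complex kernel `1/cosh(π(x+iη)/2)` is integrable in `x` (`|η| < 1`), together with its modulations. [folklore] -/
theorem integrable_exp_mul_inv_cosh {η : ℝ} (hη : |η| < 1) (a : ℝ) :
    Integrable fun x : ℝ => Complex.exp (a * x * I) *
      (Complex.cosh (((π * x / 2 : ℝ) : ℂ) + ((π * η / 2 : ℝ) : ℂ) * I))⁻¹ := by
  have hb : |π * η / 2| < π / 2 := by
    rw [abs_div, abs_mul, abs_of_pos Real.pi_pos, abs_two]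
    nlinarith [abs_nonneg η, Real.pi_pos, abs_lt.mp hη]
  have hcos : 0 < Real.cos (π * η / 2) := by
    apply Real.cos_pos_of_mem_Ioo
    constructor <;> nlinarith [Real.pi_pos, (abs_lt.mp hη).1, (abs_lt.mp hη).2]
  have him : ∀ x : ℝ, (((π * x / 2 : ℝ) : ℂ) + ((π * η / 2 : ℝ) : ℂ) * I).im = π * η / 2 := by
    intro x; simp
  have hre : ∀ x : ℝ, (((π * x / 2 : ℝ) : ℂ) + ((π * η / 2 : ℝ) : ℂ) * I).re = π * x / 2 := by
    intro x; simp
  have hne : ∀ x : ℝ, Complex.cosh (((π * x / 2 : ℝ) : ℂ) + ((π * η / 2 : ℝ) : ℂ) * I) ≠ 0 := by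
    intro x
    apply cosh_ne_zero_of_abs_im_lt
    rw [him]; exact hb
  have hcont : Continuous fun x : ℝ => Complex.exp (a * x * I) *
      (Complex.cosh (((π * x / 2 : ℝ) : ℂ) + ((π * η / 2 : ℝ) : ℂ) * I))⁻¹ :=
    Continuous.mul (by fun_prop) (Continuous.inv₀ (by fun_prop) hne)
  -- majorant `(cos(πη/2))⁻¹ · 2/(e^{π(x/2)} + e^{−π(x/2)})`
  have hmaj : Integrable fun x : ℝ => (Real.cos (π * η / 2))⁻¹ *
      (2 * (1 / (Real.exp (π * ((1 / 2 : ℝ) * x)) + Real.exp (-(π * ((1 / 2 : ℝ) * x)))))) := by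
    refine Integrable.const_mul ?_ _
    refine Integrable.const_mul ?_ _
    exact integrable_inv_exp_add_exp.comp_mul_left' (by norm_num : (1 / 2 : ℝ) ≠ 0)
  refine hmaj.mono' hcont.aestronglyMeasurable (Eventually.of_forall fun x => ?_)
  rw [norm_mul, ← Complex.ofReal_mul, Complex.norm_exp_ofReal_mul_I, one_mul]
  have h1 := norm_inv_cosh_le (z := ((π * x / 2 : ℝ) : ℂ) + ((π * η / 2 : ℝ) : ℂ) * I) (by rw [him]; exact hb)
  rw [him, hre, Real.cosh_eq] at h1
  have h2 : 0 < Real.exp (π * x / 2) + Real.exp (-(π * x / 2)) := by positivity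
  calc ‖(Complex.cosh (((π * x / 2 : ℝ) : ℂ) + ((π * η / 2 : ℝ) : ℂ) * I))⁻¹‖
      ≤ (Real.cos (π * η / 2))⁻¹ * ((Real.exp (π * x / 2) + Real.exp (-(π * x / 2))) / 2)⁻¹ := h1
    _ = (Real.cos (π * η / 2))⁻¹ *
      (2 * (1 / (Real.exp (π * ((1 / 2 : ℝ) * x)) + Real.exp (-(π * ((1 / 2 : ℝ) * x)))))) := by
        rw [show π * ((1 / 2 : ℝ) * x) = π * x / 2 by ring]
        field_simp

/-- The real part of the complex kernel is twice the strip kernel: `Re 1/cosh(π(x+iη)/2) = 2 Q^{(η)}(x)`. [folklore] -/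
theorem re_inv_cosh_eq_two_mul_stripKernel (η x : ℝ) :
    ((Complex.cosh (((π * x / 2 : ℝ) : ℂ) + ((π * η / 2 : ℝ) : ℂ) * I))⁻¹).re = 2 * stripKernel η x := by
  rw [re_inv_cosh_ofReal_add_mul_I]
  unfold stripKernel
  ring

/-- **`StripKernelSymbol`** (THEORY-R4 §2): `∫ Q^{(η)}(x) cos(kx) dx = cosh(ηk)/cosh k` for `|η| < 1`.
[folklore] -/
theorem StripKernelSymbol_holds : StripKernelSymbol := by
  intro η k hη
  have hπ : π ≠ 0 := Real.pi_pos.ne'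
  have hπc : (π : ℂ) ≠ 0 := ofReal_ne_zero.mpr hπ
  -- the kernel `H(x) = 1/cosh(π(x+iη)/2)`
  set H : ℝ → ℂ := fun x => (Complex.cosh (((π * x / 2 : ℝ) : ℂ) + ((π * η / 2 : ℝ) : ℂ) * I))⁻¹ with hH
  -- Fourier inversion at `t = k/π` and `t = -k/π`
  have h1 := weight_eq_integral hη (k / π)
  have h2 := weight_eq_integral hη (-k / π)
  have he1 : ∀ x : ℝ, Complex.exp (-(π * x * ((k / π : ℝ) : ℂ)) * I) = Complex.exp ((-k) * x * I) := by
    intro x; congr 1; push_cast; field_simp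
  have he2 : ∀ x : ℝ, Complex.exp (-(π * x * ((-k / π : ℝ) : ℂ)) * I) = Complex.exp (k * x * I) := by
    intro x; congr 1; push_cast; field_simp
  simp_rw [he1] at h1
  simp_rw [he2] at h2
  have hi1 : Integrable fun x : ℝ => Complex.exp ((-k) * x * I) * H x := by
    have := integrable_exp_mul_inv_cosh hη (-k)
    rw [hH]; convert this using 2; push_cast; ring_nf
  have hi2 : Integrable fun x : ℝ => Complex.exp (k * x * I) * H x := by
    rw [hH]; exact integrable_exp_mul_inv_cosh hη k
  -- add: `∫ 2cos(kx) H(x) dx = 4 (w(k/π) + w(−k/π))`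
  have hsum : ∫ x : ℝ, (2 * Real.cos (k * x) : ℂ) * H x
      = 4 * ((weight (π * η) (k / π) : ℂ) + (weight (π * η) (-k / π) : ℂ)) := by
    have hcos : ∀ x : ℝ, (2 * Real.cos (k * x) : ℂ) * H x
        = Complex.exp ((-k) * x * I) * H x + Complex.exp (k * x * I) * H x := by
      intro x
      rw [← add_mul, ofReal_cos, ofReal_mul, Complex.two_cos]
      congr 1
      rw [add_comm]
      congr 1
      congr 1
      ring
    simp_rw [hcos]
    rw [MeasureTheory.integral_add hi1 hi2, h1, h2, hH]
    push_cast
    ring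
  -- integrability of `cos(kx) H(x)` and real parts
  have hi3 : Integrable fun x : ℝ => (2 * Real.cos (k * x) : ℂ) * H x := by
    have h := hi1.add hi2
    refine h.congr (Eventually.of_forall fun x => ?_)
    simp only [Pi.add_apply]
    rw [← add_mul, ofReal_cos, ofReal_mul, Complex.two_cos, add_comm]
    congr 1
    congr 1
    congr 1
    ring
  have hre : ∀ x : ℝ, stripKernel η x * Real.cos (k * x) = (1 / 4 : ℝ) * ((2 * Real.cos (k * x) : ℂ) * H x).re := by
    intro x
    rw [hH]
    dsimp only
    rw [show ((2 : ℂ) * (Real.cos (k * x) : ℂ)) = ((2 * Real.cos (k * x) : ℝ) : ℂ) by push_cast; ring,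
      re_ofReal_mul, re_inv_cosh_eq_two_mul_stripKernel]
    ring
  simp_rw [hre]
  rw [MeasureTheory.integral_const_mul]
  have hreint : ∫ x : ℝ, ((2 * Real.cos (k * x) : ℂ) * H x).re = (∫ x : ℝ, (2 * Real.cos (k * x) : ℂ) * H x).re := by
    have := Complex.reCLM.integral_comp_comm hi3
    simpa only [Complex.reCLM_apply] using this
  rw [hreint, hsum]
  -- real algebra: `w(k/π) + w(−k/π) = cosh(ηk)/cosh k`
  have hcast : (4 : ℂ) * ((weight (π * η) (k / π) : ℂ) + (weight (π * η) (-k / π) : ℂ))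
      = ((4 * (weight (π * η) (k / π) + weight (π * η) (-k / π)) : ℝ) : ℂ) := by push_cast; ring
  rw [hcast, ofReal_re]
  unfold weight
  rw [Real.cosh_eq, Real.cosh_eq]
  have e1 : Real.exp (π * (k / π)) = Real.exp k := by congr 1; field_simp
  have e2 : Real.exp (-(π * (k / π))) = Real.exp (-k) := by congr 1; field_simp
  have e3 : Real.exp (π * (-k / π)) = Real.exp (-k) := by congr 1; field_simp
  have e4 : Real.exp (-(π * (-k / π))) = Real.exp k := by congr 1; field_simp
  have e5 : Real.exp (-(π * η * (k / π))) = Real.exp (-(η * k)) := by congr 1; field_simp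
  have e6 : Real.exp (-(π * η * (-k / π))) = Real.exp (η * k) := by congr 1; field_simp
  rw [e1, e2, e3, e4, e5, e6]
  have hpos : 0 < Real.exp k + Real.exp (-k) := by positivity
  field_simp
  ring

end Summit.RiemannHypothesis.RiemannHypothesis.Theorems.DbnTheory

end
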